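import Literature.AlgebraicGeometry.AbelianSchemes.RigidifiedLineBundleTensor
import Literature.AlgebraicGeometry.AbelianSchemes.RigidifiedLineBundleComapHom
import HarnessLib

/-!
# The unit hypothesis `𝒫_B|_{B × {ε_B̂}} ≅ 𝒪` DESCENDS: `hD_B` from `hD′` along `(B ◁ ψ̂)^*𝒫_B ≅ (π × 1)^*𝒫′`

Layer `Literature/AlgebraicGeometry/AbelianSchemes`, namespace `Literature.AlgebraicGeometry.AbelianSchemes.AbelianSchemeOver.DualPair`.
THEOREMS ONLY.  Cell `hodgecm-mathlib`, Hecke-link socket (B) / (X-amp) plan: every downstairs file of the two-step descent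
(★ `unitSection_comp_dualIsogeny`, ★ `mulN_comp_mulNDesc_comp_comp_dualIsogenyOver`, ★ `exists_isLambdaOfAt_mul_self_of_graphPullback`,
the (X-amp) glue) carries the unit hypothesis `hD_B : 𝒫_B|_{B × {ε_B̂}} ≅ 𝒪` of the QUOTIENT dual pair `D_B = (B̂, 𝒫_B)` as a
binder; ★ `Polarization.nonempty_unitHatSlice_iso` discharges it only once `λ_B` is a polarisation.  Here it is discharged from
the data the descent provides anyway:

SETTING: abelian schemes `A′, B / S` with dual pairs `D′ = (Â′, 𝒫′)`, `D_B = (B̂, 𝒫_B)`, an `S`-morphism `π : B → A′`, an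
`S`-morphism `ψ̂ : Â′ → B̂` preserving the unit section (`η ≫ ψ̂ = η`), and the descent isomorphism
`he : (B ◁ ψ̂)^*𝒫_B ≅ (π × 1_{Â′})^*𝒫′` on `B ×_S Â′` (★ `nonempty_pullback_whiskerLeft_poincareQuotRigid_iso`, with
`𝒩₁ = (π × 1)^*𝒫′` by ★ `poincarePullback_eq`).  THEN `hD′ : 𝒫′|_{A′ × {ε_Â′}} ≅ 𝒪` implies `hD_B`:
`(1_B × ε_B̂) = (1_B × ε_Â′) ≫ (B ◁ ψ̂)` and `(1_B × ε_Â′) ≫ (π × 1) = π ≫ (1_{A′} × ε_Â′)`, so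
`(1_B × ε_B̂)^*𝒫_B ≅ (1_B × ε_Â′)^*(π × 1)^*𝒫′ ≅ π^*(1_{A′} × ε_Â′)^*𝒫′ ≅ π^*𝒪 ≅ 𝒪`.
[MumfordFogartyKirwan1994] Ch. 6 §2 (p. 121) (normalisations of the Poincaré sheaf); [MumfordAV1970] §15 Thm. 1 (p. 143).

* `lift_unitSection_comp_whiskerLeft_left`, `lift_unitSection_comp_baseChangeHom_left` (the two factorisations);
* **`nonempty_unitHatSlice_iso_of_pullback_whiskerLeft_iso`** (the descent of the unit hypothesis).

HC_CM is proved only modulo the 7 printed citations until rung 0 closes; nothing here is about HC.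

## References
* [MumfordFogartyKirwan1994] D. Mumford, J. Fogarty, F. Kirwan, *Geometric Invariant Theory*, 3rd ed. (1994), Ch. 6 §2 (p. 121).
* [MumfordAV1970] D. Mumford, *Abelian Varieties* (1970), §15 Thm. 1 (p. 143).
-/

noncomputable section

open CategoryTheory CategoryTheory.Limits AlgebraicGeometry MonoidalCategory CartesianMonoidalCategory
open scoped MonObj

universe u

-- `Scheme.Modules` / `SheafOfModules` are not reducible (as in Mathlib's `AlgebraicGeometry/Modules/Sheaf.lean`).
set_option backward.isDefEq.respectTransparency false

namespace Literature.AlgebraicGeometry.AbelianSchemes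

open Literature.AlgebraicGeometry.Modules

namespace AbelianSchemeOver

namespace DualPair

variable {S : Scheme.{u}} {A' B : AbelianSchemeOver S} (D' : A'.DualPair) (DB : B.DualPair)
  (π : B.X ⟶ A'.X) (ψh : D'.hat.X ⟶ DB.hat.X)

/-- `(b, π_S b ≫ ε_Â′)` is a point of `B ×_S Â′`. [cite: MumfordFogartyKirwan1994, Ch. 6 §2 (p. 121)] -/
theorem id_comp_hom_eq_hom_comp_unitSection_comp_hom :
    𝟙 B.X.left ≫ B.X.hom = (B.X.hom ≫ D'.hat.unitSection) ≫ D'.hat.X.hom := by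
  rw [Category.id_comp, Category.assoc, AbelianSchemeOver.unitSection_comp_hom, Category.comp_id]

/-- **`(1_B × ε_Â′) ≫ (B ◁ ψ̂) = (1_B × ε_B̂)`** when `ψ̂` preserves the unit section. [cite: MumfordFogartyKirwan1994, Ch. 6 §2 (p. 121)] -/
theorem lift_unitSection_comp_whiskerLeft_left (hη : η[D'.hat.X] ≫ ψh = η[DB.hat.X]) :
    pullback.lift (𝟙 B.X.left) (B.X.hom ≫ D'.hat.unitSection) (id_comp_hom_eq_hom_comp_unitSection_comp_hom D') ≫
        (B.X ◁ ψh).left = unitHatSlice DB := by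
  have hε : D'.hat.unitSection ≫ ψh.left = DB.hat.unitSection := by
    change (η[D'.hat.X]).left ≫ ψh.left = (η[DB.hat.X]).left
    rw [← Over.comp_left, hη]
  apply pullback.hom_ext
  · rw [Category.assoc, Over.whiskerLeft_left_fst, pullback.lift_fst, unitHatSlice_fst]
  · rw [Category.assoc, Over.whiskerLeft_left_snd, pullback.lift_snd_assoc, unitHatSlice_snd, Category.assoc, hε]

/-- **`(1_B × ε_Â′) ≫ (π × 1_{Â′}) = π ≫ (1_{A′} × ε_Â′)`**. [cite: MumfordFogartyKirwan1994, Ch. 6 §2 (p. 121)] -/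
theorem lift_unitSection_comp_baseChangeHom_left :
    pullback.lift (𝟙 B.X.left) (B.X.hom ≫ D'.hat.unitSection) (id_comp_hom_eq_hom_comp_unitSection_comp_hom D') ≫
        (baseChangeHom π D'.hat.X.hom).left = π.left ≫ unitHatSlice D' := by
  apply pullback.hom_ext
  · rw [Category.assoc, baseChangeHom_left_comp_fst, pullback.lift_fst_assoc, Category.id_comp, Category.assoc,
      unitHatSlice_fst, Category.comp_id]
  · rw [Category.assoc, Category.assoc, unitHatSlice_snd, ← Category.assoc π.left, Over.w π]
    exact (congrArg (fun t => pullback.lift (𝟙 B.X.left) (B.X.hom ≫ D'.hat.unitSection)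
      (id_comp_hom_eq_hom_comp_unitSection_comp_hom D') ≫ t) (Over.w (baseChangeHom π D'.hat.X.hom))).trans
      (pullback.lift_snd _ _ _)

/-- **THE UNIT HYPOTHESIS DESCENDS**: if `ψ̂ : Â′ → B̂` preserves the unit section, `(B ◁ ψ̂)^*𝒫_B ≅ (π × 1)^*𝒫′` and
`𝒫′|_{A′ × {ε_Â′}} ≅ 𝒪`, then `𝒫_B|_{B × {ε_B̂}} ≅ 𝒪` — the binder `hD_B` of the quotient dual pair, from `hD′` upstairs
(★ `Polarization.nonempty_unitHatSlice_iso`) and the descent isomorphism (★ `nonempty_pullback_whiskerLeft_poincareQuotRigid_iso`).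
[cite: MumfordFogartyKirwan1994, Ch. 6 §2 (p. 121)] [cite: MumfordAV1970, §15 Thm. 1 (p. 143)] -/
theorem nonempty_unitHatSlice_iso_of_pullback_whiskerLeft_iso (hη : η[D'.hat.X] ≫ ψh = η[DB.hat.X])
    (he : Nonempty ((Scheme.Modules.pullback (B.X ◁ ψh).left).obj DB.P ≅
      (Scheme.Modules.pullback (baseChangeHom π D'.hat.X.hom).left).obj D'.P))
    (hD' : Nonempty ((Scheme.Modules.pullback (unitHatSlice D')).obj D'.P ≅ SheafOfModules.unit _)) :
    Nonempty ((Scheme.Modules.pullback (unitHatSlice DB)).obj DB.P ≅ SheafOfModules.unit _) := by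
  obtain ⟨e⟩ := he
  obtain ⟨i⟩ := hD'
  refine ⟨(Scheme.Modules.pullbackCongr (lift_unitSection_comp_whiskerLeft_left D' DB ψh hη).symm).app _ ≪≫
    ((Scheme.Modules.pullbackComp _ _).app _).symm ≪≫ (Scheme.Modules.pullback _).mapIso e ≪≫
    (Scheme.Modules.pullbackComp _ _).app _ ≪≫
    (Scheme.Modules.pullbackCongr (lift_unitSection_comp_baseChangeHom_left D' π)).app _ ≪≫
    ((Scheme.Modules.pullbackComp _ _).app _).symm ≪≫ (Scheme.Modules.pullback _).mapIso i ≪≫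
    RigidifiedLineBundle.pullbackUnitIso _⟩

end DualPair

end AbelianSchemeOver

end Literature.AlgebraicGeometry.AbelianSchemes

end
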